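import Literature.Analysis.FluidPDE.SelfSimilarEulerOutgoing
import Mathlib.Analysis.InnerProductSpace.Spectrum
import HarnessLib

/-!
# Constantin–Ignatova–Vicol 2026, Proposition 3.9 (orders `n = 0, 1`): at an outgoing stagnation
# point in the window `γ < ½ + c_*` the vorticity and its gradient vanish — proofs companion

Analysis/FluidPDE proofs file (theorems only: no definitions, no named facts, no `sorry`), third
companion of `SelfSimilarEulerProfile.lean`, next to `SelfSimilarEulerOutgoing.lean` (CIV
**Theorem 3.8**, proved there) and `SelfSimilarEulerOutgoingAnalytic.lean` (CIV **Theorem 3.10**,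
a named fact). P. Constantin, M. Ignatova, V. Vicol, *On putative self-similarity for
incompressible 3D Euler* (arXiv:2602.17570, 2026), §3.5:

> **Proposition 3.9.** Let `U` be a `C²` smooth similarity profile solving (3.3). Let `y_* ∈ ℝ³`
> be a zero of `V(y) = γ y + U(y)`. If `U` satisfies the outgoing property (3.37) locally near
> `y = y_*` for some `c_* ≥ 0`, and if `γ < 1/2 + c_*`, then we must have `Ω(y_*) = 0`.
> Additionally, for any `n ∈ ℕ` such that `Ω` is `C^{n+1}` smooth in an open neighborhood of
> `y_*`, we have that `∇ⁿΩ(y_*) = 0`.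

We PROVE the printed statement for the orders `n = 0` and `n = 1` (the tree's predicates, centre
`c`, transport field `V = γ(y − c) + U`, `Ω = curl U`), following the printed proof:

* order `0` (`curl_eq_zero_of_outgoing`): "The fact that `Ω(y_*) = 0` follows from Theorem 3.8;
  this is the base case" — the contrapositive of the tree's
  `IsSelfSimilarEulerVorticityProfile.half_add_le_of_outgoing`;
* order `1` (`fderiv_curl_eq_zero_of_outgoing`): differentiate the vorticity equation (3.4),
  `Ω + DΩ V = DU Ω`, once at `y_*` ("we apply `∂^α` to (3.4), and evaluate the resulting expression
  at `y = y_*`; using the Leibniz formula, the inductive assumption … and the fact that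
  `γ y_* + U(y_*) = 0`"): with `G = DΩ(y_*)`, `𝕊 = DU(y_*)` and `DV(y_*) = γ I + 𝕊` this reads
  `(1 + γ) G = 𝕊 G − G 𝕊` (`fderiv_curl_sylvester_of_mem_nodalSet`). Since `Ω(y_*) = 0`, `𝕊` is
  symmetric (`isSymmetric_fderiv_of_curl_eq_zero`: the antisymmetric part of `DU` is the
  vorticity, `‖curl U‖² = ½|DU − DUᵀ|²`); its eigenvalues lie in `[c_* − γ, 2(γ − c_*)]` (the
  outgoing inequality linearised, `le_inner_fderiv_of_outgoing`, and `tr 𝕊 = div U = 0` — as in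
  the proof of Theorem 3.8); in an orthonormal eigenbasis `(v_i)` of `𝕊`,
  `(1 + γ + λ_j − λ_i) ⟪G v_j, v_i⟫ = 0` with `1 + γ + λ_j − λ_i ≥ 1 + 3c_* − 2γ > 0`, so `G = 0`
  (`eq_zero_of_smul_eq_commutator`, the printed display
  "`(∂^αΩ)^i(y_*)(1 + γ m − λ_i + Σ_k α_k λ_k) = 0`" at `m = 1`).

NOT here: the orders `n ≥ 2` (the same argument with the multi-index Leibniz formula for
`∂^α(DΩ V)`; `-- TODO(general form)` below), and Theorem 3.10 (a named fact in
`SelfSimilarEulerOutgoingAnalytic.lean`).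

## Mathlib / tree search

Reused: `IsSelfSimilarEulerVorticityProfile.half_add_le_of_outgoing`, `le_inner_fderiv_of_outgoing`
(`SelfSimilarEulerOutgoing.lean`); `IsLocallyOutgoing`, `selfSimilarNodalSet`,
`IsSelfSimilarEulerProfile.isSelfSimilarEulerVorticityProfile` (`SelfSimilarEulerProfile.lean`,
`SelfSimilarEulerProfileVorticity.lean`); `norm_curl_sq_eq_frobeniusNormSq_spin_holds`,
`frobeniusNormSq_eq_sum` (`VectorCalculus(Proofs).lean`); Mathlib
`LinearMap.IsSymmetric.eigenvectorBasis` / `apply_eigenvectorBasis`, `LinearMap.trace_eq_sum_inner`,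
`fderiv_clm_apply`, `OrthonormalBasis.sum_repr'`. No new definitions, no instances, no notation.

## References

* P. Constantin, M. Ignatova, V. Vicol, *On putative self-similarity for incompressible 3D
  Euler*, arXiv:2602.17570v3 (2026), §3.5 Proposition 3.9 and its proof (pp. 11–12), display
  (3.39) (`λ₁ ≤ λ₂ ≤ λ₃ ∈ [c_* − γ, 2(γ − c_*)]`). [ConstantinIgnatovaVicol2026Putative]
-/

noncomputable section

open Set InnerProductSpace
open scoped RealInnerProductSpace

namespace Literature.Analysis.FluidPDE

section FlatVorticity

/-! ### Linear algebra: `μ G = 𝕊 G − G 𝕊` with `μ` above the spectral spread of `𝕊` forces `G = 0` -/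

section Sylvester

variable {E : Type*} [NormedAddCommGroup E] [InnerProductSpace ℝ E] [FiniteDimensional ℝ E]

/-- **The linear step of CIV's proof of Prop. 3.9 (order one).** Let `𝕊` be a symmetric operator
on a finite-dimensional real inner product space of dimension `n`, with quadratic form bounded
below, `⟪𝕊 h, h⟫ ≥ a|h|²`, and trace `t`; so every eigenvalue lies in `[a, t − (n−1)a]`. If a
linear map `G` satisfies `μ G = 𝕊 G − G 𝕊` with `μ > t − n a` (larger than any eigenvalue gap),
then `G = 0`: in an orthonormal eigenbasis `(v_i)`, `(μ − λ_i + λ_j)⟪G v_j, v_i⟫ = 0`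
(CIV: "`(∂^αΩ)^i(y_*)(1 + γ m − λ_i + Σ_k α_k λ_k) = 0` … `≥ 1 + m c_* + 2c_* − 2γ > 0`",
`m = 1`). [cite: ConstantinIgnatovaVicol2026Putative, §3.5 proof of Prop. 3.9] -/
theorem eq_zero_of_smul_eq_commutator {S G : E →L[ℝ] E}
    (hS : (S : E →ₗ[ℝ] E).IsSymmetric) {a t μ : ℝ} (ha : ∀ h, a * ‖h‖ ^ 2 ≤ ⟪S h, h⟫)
    (ht : LinearMap.trace ℝ E (S : E →ₗ[ℝ] E) = t)
    (hμ : t - (Module.finrank ℝ E : ℝ) * a < μ)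
    (hG : ∀ w, μ • G w = S (G w) - G (S w)) : G = 0 := by
  classical
  set n := Module.finrank ℝ E with hn_def
  have hn : Module.finrank ℝ E = n := rfl
  set v := hS.eigenvectorBasis hn with hv_def
  set lam : Fin n → ℝ := hS.eigenvalues hn with hlam_def
  have hSv : ∀ i, S (v i) = lam i • v i := fun i => by
    have e := hS.apply_eigenvectorBasis hn i
    simpa only [ContinuousLinearMap.coe_coe, RCLike.ofReal_real_eq_id, id_eq] using e
  have hv1 : ∀ i, ‖v i‖ = 1 := fun i => v.orthonormal.1 i
  -- eigenvalues as diagonal entries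
  have hdiag : ∀ i, ⟪S (v i), v i⟫ = lam i := fun i => by
    rw [hSv, real_inner_smul_left, real_inner_self_eq_norm_sq, hv1, one_pow, mul_one]
  -- lower bound on every eigenvalue
  have hlam_ge : ∀ i, a ≤ lam i := fun i => by
    have e := ha (v i)
    rw [hv1, one_pow, mul_one, hdiag] at e
    exact e
  -- the trace is the sum of the eigenvalues
  have htrace : ∑ i, lam i = t := by
    rw [← ht, LinearMap.trace_eq_sum_inner _ v]
    refine Finset.sum_congr rfl fun i _ => ?_
    rw [← hdiag i, real_inner_comm]
    rfl
  -- upper bound on every eigenvalue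
  have hlam_le : ∀ i, lam i ≤ t - (n - 1 : ℝ) * a := fun i => by
    have hsplit := Finset.add_sum_erase Finset.univ lam (Finset.mem_univ i)
    have hrest : ((Finset.univ.erase i).card : ℝ) * a ≤ ∑ k ∈ Finset.univ.erase i, lam k := by
      have := Finset.card_nsmul_le_sum (Finset.univ.erase i) lam a fun k _ => hlam_ge k
      rwa [nsmul_eq_mul] at this
    have hcard : ((Finset.univ.erase i).card : ℝ) = n - 1 := by
      rw [Finset.card_erase_of_mem (Finset.mem_univ i), Finset.card_univ, Fintype.card_fin,
        Nat.cast_sub (Nat.succ_le_of_lt (Fin.pos i)), Nat.cast_one]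
    rw [hcard] at hrest
    linarith [hsplit, htrace]
  -- all matrix entries of `G` in the eigenbasis vanish
  have hentry : ∀ i j, ⟪G (v j), v i⟫ = 0 := fun i j => by
    have hsym : ⟪S (G (v j)), v i⟫ = ⟪G (v j), S (v i)⟫ := hS _ _
    have e : ⟪μ • G (v j), v i⟫ = ⟪S (G (v j)) - G (S (v j)), v i⟫ := by rw [hG]
    rw [real_inner_smul_left, inner_sub_left, hsym, hSv i, hSv j, map_smul, real_inner_smul_right,
      real_inner_smul_left] at e
    have hcoef : 0 < μ - lam i + lam j := by
      have h1 := hlam_le i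
      have h2 := hlam_ge j
      have h3 : t - (n : ℝ) * a = t - (n - 1 : ℝ) * a - a := by ring
      linarith
    have hprod : (μ - lam i + lam j) * ⟪G (v j), v i⟫ = 0 := by linarith
    rcases mul_eq_zero.1 hprod with h0 | h0
    · exact absurd h0 hcoef.ne'
    · exact h0
  -- hence `G` kills the eigenbasis, hence everything
  have hGv : ∀ j, G (v j) = 0 := fun j => by
    rw [← v.sum_repr' (G (v j))]
    refine Finset.sum_eq_zero fun i _ => ?_
    rw [real_inner_comm, hentry i j, zero_smul]
  ext1 x
  rw [← v.sum_repr' x, map_sum, zero_apply]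
  refine Finset.sum_eq_zero fun i _ => ?_
  rw [map_smul, hGv, smul_zero]

end Sylvester

/-! ### A curl-free gradient is symmetric -/

/-- If `curl U(x) = 0` then the velocity gradient `DU(x)` is a symmetric operator: its
antisymmetric part `DU − DUᵀ` has Frobenius norm `√2 |curl U(x)|` (Majda–Bertozzi (1.21);
the tree's `norm_curl_sq_eq_frobeniusNormSq_spin`). Used by CIV in the form "in view of
`Ω(y_*) = 0`, we have that `∇U(y_*) = 𝕊_{y_*}`". [cite: ConstantinIgnatovaVicol2026Putative, §3.5 proof of Prop. 3.9] -/
theorem isSymmetric_fderiv_of_curl_eq_zero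
    {U : EuclideanSpace ℝ (Fin 3) → EuclideanSpace ℝ (Fin 3)} {x : EuclideanSpace ℝ (Fin 3)}
    (hU : DifferentiableAt ℝ U x) (hΩ : curl U x = 0) :
    ((fderiv ℝ U x : EuclideanSpace ℝ (Fin 3) →L[ℝ] EuclideanSpace ℝ (Fin 3)) :
      EuclideanSpace ℝ (Fin 3) →ₗ[ℝ] EuclideanSpace ℝ (Fin 3)).IsSymmetric := by
  have hfrob : frobeniusNormSq (spin U x) = 0 := by
    have e := norm_curl_sq_eq_frobeniusNormSq_spin_holds U x hU
    rw [hΩ, norm_zero] at e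
    have : (0 : ℝ) ^ 2 = 0 := by norm_num
    rw [this] at e
    linarith
  -- a map with vanishing Frobenius norm is zero
  have hspin : spin U x = 0 := by
    set b := stdOrthonormalBasis ℝ (EuclideanSpace ℝ (Fin 3))
    rw [frobeniusNormSq_eq_sum b] at hfrob
    have hterm : ∀ i, ‖spin U x (b i)‖ ^ 2 = 0 := fun i =>
      (Finset.sum_eq_zero_iff_of_nonneg fun j _ => sq_nonneg _).1 hfrob i (Finset.mem_univ i)
    have hbi : ∀ i, spin U x (b i) = 0 := fun i => by
      have := hterm i
      rwa [sq_eq_zero_iff, norm_eq_zero] at this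
    ext1 y
    rw [← b.sum_repr' y, map_sum, zero_apply]
    refine Finset.sum_eq_zero fun i _ => ?_
    rw [map_smul, hbi, smul_zero]
  -- `spin = DU − DUᵀ`
  have hadj : ContinuousLinearMap.adjoint (fderiv ℝ U x) = fderiv ℝ U x := by
    have e : fderiv ℝ U x - ContinuousLinearMap.adjoint (fderiv ℝ U x) = 0 := hspin
    exact (sub_eq_zero.1 e).symm
  intro a b
  change ⟪fderiv ℝ U x a, b⟫ = ⟪a, fderiv ℝ U x b⟫
  rw [← ContinuousLinearMap.adjoint_inner_right, hadj]

/-! ### CIV Proposition 3.9, orders zero and one -/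

namespace IsSelfSimilarEulerVorticityProfile

variable {γ : ℝ} {c : EuclideanSpace ℝ (Fin 3)}
variable {U : EuclideanSpace ℝ (Fin 3) → EuclideanSpace ℝ (Fin 3)}

/-- **CIV Proposition 3.9, order `0`** (the base case, = the contrapositive of Theorem 3.8): at a
stagnation point `z` of `V = γ(y − c) + U` near which the outgoing inequality
`V(y)·(y − z) ≥ c_*|y − z|²` (`|y − z| ≤ ε_*`) holds, `γ < ½ + c_*` forces `Ω(z) = 0`.
[cite: ConstantinIgnatovaVicol2026Putative, §3.5 Prop. 3.9] -/
theorem curl_eq_zero_of_outgoing (h : IsSelfSimilarEulerVorticityProfile γ c U)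
    {z : EuclideanSpace ℝ (Fin 3)} (hz : z ∈ selfSimilarNodalSet γ c U) {κ ε : ℝ} (hε : 0 < ε)
    (hout : ∀ y, ‖y - z‖ ≤ ε → κ * ‖y - z‖ ^ 2 ≤ ⟪selfSimilarTransport γ c U y, y - z⟫)
    (hγ : γ < 1 / 2 + κ) : curl U z = 0 := by
  by_contra hΩ
  exact absurd (h.half_add_le_of_outgoing hz hΩ hε hout) (not_le.2 hγ)

/-- **The once-differentiated vorticity equation at a stagnation point.** If `Ω = curl U` is `C²`
near a zero `z` of `V = γ(y − c) + U` with `Ω(z) = 0`, then differentiating (3.4),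
`Ω + DΩ V = DU Ω`, at `z` gives, with `G = DΩ(z)` and `𝕊 = DU(z)` (so `DV(z) = γ I + 𝕊`),
`(1 + γ) G w = 𝕊 (G w) − G (𝕊 w)` for every `w` (the terms `D²Ω(z)(w, V(z))` and
`D²U(z)(w, Ω(z))` of the Leibniz rule vanish). [cite: ConstantinIgnatovaVicol2026Putative, §3.5 proof of Prop. 3.9] -/
theorem fderiv_curl_sylvester_of_mem_nodalSet (h : IsSelfSimilarEulerVorticityProfile γ c U)
    {z : EuclideanSpace ℝ (Fin 3)} (hz : z ∈ selfSimilarNodalSet γ c U)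
    (hΩ2 : ContDiffAt ℝ 2 (curl U) z) (hΩz : curl U z = 0) (w : EuclideanSpace ℝ (Fin 3)) :
    (1 + γ) • fderiv ℝ (curl U) z w =
      fderiv ℝ U z (fderiv ℝ (curl U) z w) - fderiv ℝ (curl U) z (fderiv ℝ U z w) := by
  have hU2 : ContDiff ℝ 2 U := h.contDiff_velocity
  -- differentiability at `z` of the ingredients
  have dΩ : DifferentiableAt ℝ (curl U) z := (differentiable_curl_of_contDiff hU2) z
  have dDΩ : DifferentiableAt ℝ (fderiv ℝ (curl U)) z :=
    (hΩ2.fderiv_right (m := 1) (by norm_num)).differentiableAt (by norm_num)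
  have dU : DifferentiableAt ℝ U z := (hU2.differentiable (by norm_num)) z
  have dDU : DifferentiableAt ℝ (fderiv ℝ U) z :=
    ((hU2.fderiv_right (m := 1) (by norm_num)).differentiable (by norm_num)) z
  have hVd : HasFDerivAt (selfSimilarTransport γ c U)
      (γ • ContinuousLinearMap.id ℝ (EuclideanSpace ℝ (Fin 3)) + fderiv ℝ U z) z :=
    (((hasFDerivAt_id z).sub_const c).fun_const_smul γ).fun_add dU.hasFDerivAt
  have dV : DifferentiableAt ℝ (selfSimilarTransport γ c U) z := hVd.differentiableAt
  have hVz : selfSimilarTransport γ c U z = 0 := hz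
  -- (3.4) as an identity of functions
  have hfun : (fun y => curl U y + fderiv ℝ (curl U) y (selfSimilarTransport γ c U y)) =
      fun y => fderiv ℝ U y (curl U y) := by
    funext y
    exact h.vorticity_eq y
  have hD := congrArg (fun f => fderiv ℝ f z w) hfun
  rw [fderiv_fun_add dΩ (dDΩ.clm_apply dV), fderiv_clm_apply dDΩ dV, fderiv_clm_apply dDU dΩ,
    hVz, hΩz, hVd.fderiv] at hD
  simp only [map_zero, add_zero, _root_.add_apply, ContinuousLinearMap.comp_apply,
    _root_.smul_apply, ContinuousLinearMap.id_apply, map_add, map_smul] at hD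
  rw [add_smul, one_smul]
  -- `hD : G w + (γ • G w + G (𝕊 w)) = 𝕊 (G w)`
  linear_combination (norm := module) hD

/-- **CIV Proposition 3.9, order `1`.** Let `U` be a `C²` self-similar velocity profile in
vorticity form (3.4), `z` a stagnation point of `V = γ(y − c) + U` near which the outgoing
inequality `V(y)·(y − z) ≥ c_*|y − z|²` holds for `|y − z| ≤ ε_*` with `c_* = κ ≥ 0`, `ε_* > 0`,
and assume `Ω = curl U` is `C²` on a neighbourhood of `z`. If `γ < ½ + c_*` then `∇Ω(z) = 0`
(and `Ω(z) = 0`, `curl_eq_zero_of_outgoing`). Proof as printed: `Ω(z) = 0` by Theorem 3.8, so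
`𝕊 = DU(z)` is symmetric; the once-differentiated equation `(1+γ)G = 𝕊G − G𝕊`
(`fderiv_curl_sylvester_of_mem_nodalSet`); the spectral bounds `λ(𝕊) ⊂ [c_* − γ, 2(γ − c_*)]`
from the linearised outgoing inequality and `tr 𝕊 = div U(z) = 0`; and
`1 + γ + λ_j − λ_i ≥ 1 + 3c_* − 2γ > 0` (`eq_zero_of_smul_eq_commutator`).
[cite: ConstantinIgnatovaVicol2026Putative, §3.5 Prop. 3.9] -/
theorem fderiv_curl_eq_zero_of_outgoing (h : IsSelfSimilarEulerVorticityProfile γ c U)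
    {z : EuclideanSpace ℝ (Fin 3)} (hz : z ∈ selfSimilarNodalSet γ c U)
    (hΩ2 : ContDiffAt ℝ 2 (curl U) z) {κ ε : ℝ} (hκ : 0 ≤ κ) (hε : 0 < ε)
    (hout : ∀ y, ‖y - z‖ ≤ ε → κ * ‖y - z‖ ^ 2 ≤ ⟪selfSimilarTransport γ c U y, y - z⟫)
    (hγ : γ < 1 / 2 + κ) : fderiv ℝ (curl U) z = 0 := by
  have hΩz : curl U z = 0 := h.curl_eq_zero_of_outgoing hz hε hout hγ
  have hU2 : ContDiff ℝ 2 U := h.contDiff_velocity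
  have dU : DifferentiableAt ℝ U z := (hU2.differentiable (by norm_num)) z
  -- `𝕊 = DU(z)` is symmetric
  have hS := isSymmetric_fderiv_of_curl_eq_zero dU hΩz
  -- linearised outgoing inequality: `⟪𝕊 v, v⟫ ≥ (κ − γ)|v|²`
  have hVd : HasFDerivAt (selfSimilarTransport γ c U)
      (γ • ContinuousLinearMap.id ℝ (EuclideanSpace ℝ (Fin 3)) + fderiv ℝ U z) z :=
    (((hasFDerivAt_id z).sub_const c).fun_const_smul γ).fun_add dU.hasFDerivAt
  have hVz : selfSimilarTransport γ c U z = 0 := hz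
  have ha : ∀ v : EuclideanSpace ℝ (Fin 3), (κ - γ) * ‖v‖ ^ 2 ≤ ⟪fderiv ℝ U z v, v⟫ := by
    intro v
    have e := le_inner_fderiv_of_outgoing hVd hVz hε hout v
    rw [_root_.add_apply, _root_.smul_apply, ContinuousLinearMap.id_apply, inner_add_left,
      inner_smul_left, conj_trivial, real_inner_self_eq_norm_sq] at e
    linarith
  -- `tr 𝕊 = div U(z) = 0`
  have ht : LinearMap.trace ℝ _
      (fderiv ℝ U z : EuclideanSpace ℝ (Fin 3) →ₗ[ℝ] EuclideanSpace ℝ (Fin 3)) = 0 := h.divFree z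
  -- the spectral-gap condition `1 + γ > 0 − 3(κ − γ)`
  have hμ : 0 - (Module.finrank ℝ (EuclideanSpace ℝ (Fin 3)) : ℝ) * (κ - γ) < 1 + γ := by
    rw [finrank_euclideanSpace, Fintype.card_fin]
    push_cast
    linarith
  exact eq_zero_of_smul_eq_commutator hS ha ht hμ
    (h.fderiv_curl_sylvester_of_mem_nodalSet hz hΩ2 hΩz)

-- TODO(general form): CIV Prop. 3.9 for all orders `n` — `Ω` of class `C^{n+1}` near `z` ⇒
-- `iteratedFDeriv ℝ n (curl U) z = 0` (multi-index Leibniz rule for `∂^α(DΩ V)` and the same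
-- eigenbasis computation with coefficient `1 + γ m − λ_i + Σ_k α_k λ_k ≥ 1 + m c_* + 2c_* − 2γ`).

/-- **CIV Proposition 3.9 (orders `0, 1`) with the local outgoing property of Definition 3.7**:
at every stagnation point of a locally outgoing `C²` vorticity-form profile with `γ < ½ + c_*`,
`Ω = 0`, and `∇Ω = 0` wherever `Ω` is `C²`. [cite: ConstantinIgnatovaVicol2026Putative, §3.5 Prop. 3.9] -/
theorem curl_eq_zero_of_isLocallyOutgoing (h : IsSelfSimilarEulerVorticityProfile γ c U)
    {κ ε : ℝ} (hout : IsLocallyOutgoing γ c U κ ε) (hγ : γ < 1 / 2 + κ)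
    {z : EuclideanSpace ℝ (Fin 3)} (hz : z ∈ selfSimilarNodalSet γ c U) : curl U z = 0 :=
  h.curl_eq_zero_of_outgoing hz hout.pos (hout.outgoing z hz) hγ

/-- **CIV Proposition 3.9, order `1`, with Definition 3.7.** [cite: ConstantinIgnatovaVicol2026Putative, §3.5 Prop. 3.9] -/
theorem fderiv_curl_eq_zero_of_isLocallyOutgoing (h : IsSelfSimilarEulerVorticityProfile γ c U)
    {κ ε : ℝ} (hout : IsLocallyOutgoing γ c U κ ε) (hγ : γ < 1 / 2 + κ)
    {z : EuclideanSpace ℝ (Fin 3)} (hz : z ∈ selfSimilarNodalSet γ c U)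
    (hΩ2 : ContDiffAt ℝ 2 (curl U) z) : fderiv ℝ (curl U) z = 0 :=
  h.fderiv_curl_eq_zero_of_outgoing hz hΩ2 hout.nonneg hout.pos (hout.outgoing z hz) hγ

/-- **In the Chae–Shvydkoy window `γ < ½`** (any `c_* ≥ 0`): every stagnation point of a locally
outgoing profile is a zero of `Ω` and, where `Ω ∈ C²`, of `∇Ω`. [cite: ConstantinIgnatovaVicol2026Putative, §3.5 Prop. 3.9] -/
theorem curl_and_fderiv_curl_eq_zero_of_lt_half (h : IsSelfSimilarEulerVorticityProfile γ c U)
    {κ ε : ℝ} (hout : IsLocallyOutgoing γ c U κ ε) (hγ : γ < 1 / 2)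
    {z : EuclideanSpace ℝ (Fin 3)} (hz : z ∈ selfSimilarNodalSet γ c U)
    (hΩ2 : ContDiffAt ℝ 2 (curl U) z) : curl U z = 0 ∧ fderiv ℝ (curl U) z = 0 :=
  have hγ' : γ < 1 / 2 + κ := by linarith [hout.nonneg]
  ⟨h.curl_eq_zero_of_isLocallyOutgoing hout hγ' hz,
    h.fderiv_curl_eq_zero_of_isLocallyOutgoing hout hγ' hz hΩ2⟩

end IsSelfSimilarEulerVorticityProfile

/-! ### Velocity-form profiles -/

namespace IsSelfSimilarEulerProfile

variable {γ : ℝ} {c : EuclideanSpace ℝ (Fin 3)}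
variable {U : EuclideanSpace ℝ (Fin 3) → EuclideanSpace ℝ (Fin 3)} {P : EuclideanSpace ℝ (Fin 3) → ℝ}

/-- **CIV Proposition 3.9, order `0`, for velocity-form profiles** ((3.3) ⇒ (3.4)). [cite: ConstantinIgnatovaVicol2026Putative, §3.5 Prop. 3.9] -/
theorem curl_eq_zero_of_isLocallyOutgoing (h : IsSelfSimilarEulerProfile γ c U P) {κ ε : ℝ}
    (hout : IsLocallyOutgoing γ c U κ ε) (hγ : γ < 1 / 2 + κ) {z : EuclideanSpace ℝ (Fin 3)}
    (hz : z ∈ selfSimilarNodalSet γ c U) : curl U z = 0 :=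
  h.isSelfSimilarEulerVorticityProfile.curl_eq_zero_of_isLocallyOutgoing hout hγ hz

/-- **CIV Proposition 3.9, order `1`, for velocity-form profiles**: for a `C³` velocity profile
(so that `Ω = curl U ∈ C²`), at every stagnation point of a locally outgoing transport field with
`γ < ½ + c_*`, `∇Ω = 0`. [cite: ConstantinIgnatovaVicol2026Putative, §3.5 Prop. 3.9] -/
theorem fderiv_curl_eq_zero_of_isLocallyOutgoing (h : IsSelfSimilarEulerProfile γ c U P)
    (hU3 : ContDiff ℝ 3 U) {κ ε : ℝ} (hout : IsLocallyOutgoing γ c U κ ε) (hγ : γ < 1 / 2 + κ)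
    {z : EuclideanSpace ℝ (Fin 3)} (hz : z ∈ selfSimilarNodalSet γ c U) :
    fderiv ℝ (curl U) z = 0 :=
  h.isSelfSimilarEulerVorticityProfile.fderiv_curl_eq_zero_of_isLocallyOutgoing hout hγ hz
    ((contDiff_curl (n := 2) (by exact_mod_cast hU3)).contDiffAt)

/-- **Exponent form** (route EulerZoomLiouville: `γ = 1/(2+ρ)`, window `ρ > 0 ⟺ 0 < γ < ½`):
in the window, every stagnation point of a locally outgoing `C³` profile is a zero of `Ω` and of
`∇Ω`. [cite: ConstantinIgnatovaVicol2026Putative, §3.5 Prop. 3.9] -/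
theorem curl_and_fderiv_curl_eq_zero_of_exponent (h : IsSelfSimilarEulerProfile γ c U P)
    (hU3 : ContDiff ℝ 3 U) {ρ : ℝ} (hρ : 0 < ρ) (hγ : γ = 1 / (2 + ρ)) {κ ε : ℝ}
    (hout : IsLocallyOutgoing γ c U κ ε) {z : EuclideanSpace ℝ (Fin 3)}
    (hz : z ∈ selfSimilarNodalSet γ c U) : curl U z = 0 ∧ fderiv ℝ (curl U) z = 0 := by
  have hγ' : γ < 1 / 2 + κ := by
    have h2ρ : (0 : ℝ) < 2 + ρ := by linarith
    have hlt : γ < 1 / 2 := by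
      rw [hγ]
      exact one_div_lt_one_div_of_lt two_pos (by linarith)
    linarith [hout.nonneg]
  exact ⟨h.curl_eq_zero_of_isLocallyOutgoing hout hγ' hz,
    h.fderiv_curl_eq_zero_of_isLocallyOutgoing hU3 hout hγ' hz⟩

end IsSelfSimilarEulerProfile

end FlatVorticity

end Literature.Analysis.FluidPDE

end
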